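import Summits.QuantumFields.YangMills.Theorems.BackwardLiouvilleRigidityOneStepBackwardContractionAdmDescentDisintegration
import HarnessLib

/-!
R-CUT-χ (2026-08-30 ≈19:3xZ, g26; LEAD w3 g23 WORD №1 (iii) «R-CUT-χ», ideator №3 GO): the `sfCut` numerals (½, ¾) ↦ (½, 24∕25) —
`sfCut θ U = ∏ p, max 0 (min 1 ((24/25·θ − dist1 (plaqHol U p)) / ((24/25 − 1/2)·θ)))`: `= 1` iff every `dist1 ≤ θ/2` (unchanged), `= 0` iff some
`dist1 ≥ (24/25)θ`, `{sfCut > 0} = {PlaqSmall ((24/25)θ)}` — so that the one-step spread lifts the fibre-mean rows need exist for EVERY odd block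
size `L ≥ 3` from LANDED kernels (gain `0.9482·` at `L = 3` < 24/25; LEAD (M3) letter).  Every row ∕ junction text not naming the constant is
byte-identical to the previous version.

# LINE g25-1 «organ_tangent» v2.6 — the one-step organ O1 cut BY TAYLOR ORDER on the SMALL-FIELD-LOCALISED reference fibre law
# (crux stmt-QuantumFields-20520 `FluctuationComparisonRegPrIntL`, PATH B package `runpair_organ` v17.1 = R-c + R-a + R-n4, smooth cut)

v2.5 (≈18:3xZ): frame = O1 v17.1's (SMOOTH tower cut `μ j = descend_* (sfCut θ_{j+1}·μ (j+1))`, (R1) of LEAD w3 g22 ∕ ★★OWNER g38 №151; O1 text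
byte-identical with HOME `runpair_organ.v171.lean`); bodies byte-identical to v2.4∕v2.3.

v2.4 (2026-08-30, g25; ★★OWNER g37 №139 ∕ RULING №54, LEAD w3 g22; typing note D25-8 «lf-transplant»; critic g14 #527∕#531 Q1 «frame
inhabitation»): the rows are RE-COPIED BY SCRIPT over the v17 FRAME of O1 — ANCHORED to the run family `ν` and a pair `K ≤ K'`, towers =
the runs on `[Ts, T]` and their SMALL-FIELD PROJECTIONS below the seed height `Ts` (cut-consistency), sub-probability, class membership
MODULO A CONSTANT FACTOR (`∃ κ, MemAtHeight … (e^κ·ρ_j)`), the step asked for `j + 1 ≤ Ts`; every row BODY (VER∘'s `m`-clause, LIN∘'s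
and JEN∘'s `(c′, a′, w′)` conclusions, `sfCut`) is BYTE-IDENTICAL to v2.3.  WHAT v17 DOES TO THE CUT: below the seed
`ρ_j = Z_j·∫ sfCut_{j+1}·ρ_{j+1} dσ` (`Z_j` = the Haar co-area factor, common to both towers), so `h_j = log ρ_j − log ρ′_j` IS the
localised fibre-mean currency's exact logarithmic ratio `log E′_σ[χ e^{h}] − log E′_σ[χ]`-type quantity and the JENSEN GAP `q = h_j − m` is
now a SMALL-FIELD conditional cumulant ONLY — no collar ∕ large-field fibre mass enters (the `(1−χ)`-part of v2–v2.3's JEN∘ mechanism is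
GONE; LINE g25-4 «jensen_collar» RETIRES, its COLLAR∘ is moot); the v2.3 pre-v17 rows were, by Q1, provable by emptiness over the
normalised generic frame (no probability member of an admissible class exists from a height on) — the v17 frame is inhabited by the runs.

bears_on: R3:stmt-QuantumFields-20520 [ym-r3-idea-1-g25] · LENS «control» (Lyapunov norm `x = a + Θ·w`; C¹-stability of the
backward step = norm of the TANGENT map + CURVATURE remainder).

HONESTY.  Nothing of Bałaban's is asserted here; every row is a `def … : Prop` restated or cut from the package, every `stub_*`
is a `sorry`, and the only kernel-checked content is the ★ junction `oneStepContractionRun_of_tangentCut`.  Item 20520 and the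
rung leaf `…T3YM3TorusStatement.YM3TorusSU2` are NOT proved.  R3 = SU(2) YM₃ on T³ — NOT d = 4, NOT infinite volume, NOT a mass
gap, NOT Clay.  No summit is proved by a line.

THE CUT.  O1 `RunPairOrgan.OneStepContractionRun` (restated verbatim below as `OneStepContractionRun`; plug
`RunPairOrgan.stub_oneStepContractionRun`, composition `unitLawCauchy_perL_of … h3 …` / `backwardStabilityFinSup_of_stubs` of
`Lines/runpair_organ.lean` v15) bounds the marginal-weighted currency `x' = a' + Θ_j w'` of the height-`j` discrepancy
`h_j := log ρ_j − log ρ'_j` of two class towers by `(1 + ε_j + εd_n + C·x)·x + δ_j`.  Let `σ_j` be the landed disintegration of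
product Haar along Bałaban's averaging (`FibreLaplace.stub_descentDisintegration`, Theorems) and
`m(V) := E′_χ[h | descend = V] := (∫ χ·h·ρ′_{j+1} dσ_V)/(∫ χ·ρ′_{j+1} dσ_V)`, `h := log ρ_{j+1} − log ρ′_{j+1}`,
`χ := sfCut θ_{j+1}` (v2.1: the fixed CONTINUOUS SMALL-FIELD CUTOFF on the FINE field, `= 1` where all plaquette defects are `≤ θ_{j+1}/2`,
`= 0` where some defect is `≥ (24∕25)θ_{j+1}` — compact support inside the open fine window) — the conditional mean of the fine discrepancy on the SMALL-FIELD PART of the fibre over `V` under the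
REFERENCE tower (its first variation in the direction `χh`).  Exactly (`FibreLaplace.stub_fibreIdentityAE`, Theorems):
`h_j(V) = log E′[e^{h} | V]`, hence the TAYLOR SPLIT `h_j = m + q`, `q := h_j − m = log E′[e^{h − m(V)} | V]`,
`q ≥ log E′[χ | V]` (Jensen on the χ-part; `1 − E′[χ | V]` is a large-field ∕ collar fibre mass, floor class).  The rows type the two
orders SEPARATELY:
* VER∘ `FibreMeanVersionCan` (v2.3) — in Bałaban's parameter regime `0 < γ ≤ 1`, `0 < b₀`, `0 < p₀` and from a height `jV(F, γ, b₀, p₀)` on,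
  a window-continuous version `m` of the LOCALISED fibre mean exists
  (`χ·h·ρ′` is bounded: `supp χ = {∀ p, dist1 ≤ (24∕25)θ_{j+1}}` is COMPACT inside the OPEN fine window, on which the frame makes `ρ, ρ′`
  continuous and positive — pinched by compactness, no class bound used; continuity in `V` = continuity of co-area integrals of
  continuous integrands supported in the regular region of the averaging map, plus disintegration uniqueness a.e.);
* LIN∘ `TangentTransportCan` — FIRST ORDER: `m` has a presentation `(c′, a′, w′)` with the LINEAR bound
  `a′ + Θ_j w′ ≤ (1 + ε_j + εd_n)·x + δ_j` (no `C`, no `x²`: the tangent map `h ↦ E′[h | ·]` of the backward step is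
  `(1 + ε_j + εd_n)`-non-expansive in the currency — one-loop coupling discrepancy `ε_j`, equilibration defect `εd_n`, large-field floor);
* JEN∘ `JensenGapCan` — SECOND ORDER: the Jensen gap `q` is window-clustered with `Θ_j w′_q ≤ C·x·x + δ_j` (no linear term: `q` is a
  conditional log-Laplace transform of the centred discrepancy, `= ½ Var′(h | V) + …`, quadratic in `x` by Brascamp–Lieb on the
  uniformly convex small-field fibre and the decay of the fibre covariance);
and the ★ junction re-assembles O1's `(1 + ε_j + εd_n + C·x)·x + δ_j` with `w′ := w′_lin + w′_q`, `δ := δᴸ + δᴶ` (the floor class is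
closed under sums — proved), `θ` shared through the rows' «∀ θ ∈ (0, θ₀]» heads.  KT-W (`Lines/backward_stability_adm.md`) is honoured:
every bound is on the COMBINED currency `x` of an input coming from two CLASS towers (no Wilson-exact channel is ever transported alone —
the register cut marginal | remainder is dead by KT-W, census g25 D25-1); B-8(a) is honoured: O1's tower block (Mem at `j+1`, `j+2 ≤ T`)
is carried verbatim.  Over the inequality-level class `BalabanUVClass.Mem` the rows are the same kind of bet as O1 itself.
v2 (2026-08-30, answer to idea-crit-5 #514 (ii) MUST-FIX «VER∘ v1 FALSE AS TYPED»): v1 took `m` = the EXACT fibre mean `E′[h | V]`; `Mem`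
constrains a density two-sidedly only on `{PlaqSmall}` and only from above off it, so (critic) `h·ρ′` need not be fibre-integrable, and
(pen, census D25-4) even for fibrewise log-integrable pairs NO window-continuous version need exist: move reference mass WITHIN the deep
large-field part of each fibre over a half-window `B` (`ρ_{j+1} := ρ′_{j+1}(1 + 1_B(descend U)·ψ(U))`, `ψ` bounded, `ρ′σ_V`-mean zero,
supported where some fine plaquette defect is `≥ 1`) — every tower density is unchanged on every window, `ρ_j = ρ′_j`, `Mem` and the
frame hold, `|h| ≤ log 2`, and `E′[h | V] = 1_B(V)·κ(V)` with `κ < 0` (strict Jensen) JUMPS across `∂B`.  So the critic's exit (β)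
(«HInt ⇒ continuous version», plus a residual COR∘) is dead as well, and the value truncation `h ∧ (−K_j)` of exit (γ) does not see the
jump either.  EXIT TAKEN (γ′, «localised tangent»): the cutoff sits on the FINE FIELD, inside the expectation — `m := E′_χ[h | V]` never
integrates over the part of the fibre where the class is silent; VER∘ becomes unconditional, LIN∘'s mechanism is untouched (the tangent
map restricted to small fine fields is all Bałaban's expansions ever see), and JEN∘ books the collar ∕ large-field fibre mass
`1 − E′[χ | V]` and `E′[(1−χ)e^{h−m} | V]` at the floor `δ_j` (Wilson weight `e^{−β_{j+1}θ²_{j+1}/4}` of the collar, `Mem.large` beyond).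
Also v2: the rows' O1 text and κ-heads follow `Lines/runpair_organ.lean` v16 (O1-R1 «κ-CEILING»: `∃ κ₀ > 0, ∀ κ ∈ (0, κ₀]`).

Rows restated BY TEXT (never imported): O1 = `RunPairOrgan.OneStepContractionRun` (byte-identical body, `Lines/runpair_organ.lean`
v16, the O1-R1 text).  Landed organs used BY NAME: `FibreLaplace.stub_descentDisintegration` (D).  Cited, not used in the junction:
`FibreLaplace.stub_fibreIdentityAE` (I), `FibreLaplace.stub_aeUpgrade` (U).
-/

open MeasureTheory Filter Topology
open Literature.MathematicalPhysics.QuantumFieldTheory.Balaban1983to89 T3ContinuumYM3Torus T3NestedUnitLaws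
  T3UnitLawDensityEML T4Continuum BalabanUVClass T3UnitScaleTilt

namespace Summit.QuantumFields.YangMills.Cruxes.FluctuationComparisonRegPrIntL.OrganTangent

/-- The CONTINUOUS SMALL-FIELD CUTOFF on fine fields (v2.1, exit γ′): `1` where every plaquette has `dist1 ≤ θ/2`, `0` as soon as
some plaquette has `dist1 ≥ (24∕25)θ` — its support `{∀ p, dist1 ≤ (24∕25)θ}` is a COMPACT subset of the OPEN window `{PlaqSmall θ}` (v2.1, census
D25-5: a cutoff reaching the window edge would let `log ρ` blow up non-integrably there for non-admissible `prm`), multilinear in between.  A fixed elementary real function of the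
field; nothing is assumed about it (its continuity for the `SU(2)` instance is the VER∘ prover's to show). -/
noncomputable def sfCut {P : Params} {k : ℕ} (θ : ℝ) (U : GaugeField P k ↥(Matrix.specialUnitaryGroup (Fin 2) ℂ)) : ℝ :=
  ∏ p : Plaq P k, max 0 (min 1 ((24 / 25 * θ - dist1 (GaugeField.plaqHol U p)) / ((24 / 25 - 1 / 2) * θ)))

/-- O1 · THE ONE-STEP ORGAN of the PATH B package (v17 = R-c + R-a + R-n4: anchored, SF-projected below the seed, membership modulo
constants), restated BY TEXT (byte-identical with `RunPairOrgan.OneStepContractionRun` of `runpair_organ` v17.1 (smooth cut), HOME bytes `runpair_organ.v171.lean` —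
the tree's `Lines/runpair_organ.lean` is v15 until the v17 booking; docked by text identity, never imported). -/
def OneStepContractionRun : Prop :=
  ∃ γ₁ : ℝ, 0 < γ₁ ∧ ∀ (F : T3Family) (γ : ℝ), 0 < γ → γ ≤ γ₁ → ∀ (b₀ p₀ : ℝ) (j₀ : ℕ) (prm : ℕ → ClassParams) (η : ℕ → ℝ), 0 < b₀ → 0 < p₀ → AdmissibleClassParams F γ b₀ p₀ prm → (∀ j, 0 ≤ η j) → Summable η → Summable (fun i => ∑' k, η (k + i)) → Tendsto (fun j => (∑' k, η (k + j)) * ((1 + 2 * ((F.L : ℝ) ^ j / γ) * (Fintype.card (Plaq (F.P j) 0) : ℝ)) * (Fintype.card (PBond (F.P j) 0) : ℝ) ^ 2)) atTop (𝓝 0) → ∃ κ₀ : ℝ, 0 < κ₀ ∧ ∀ (κ : ℝ), 0 < κ → κ ≤ κ₀ → ∃ (θ C w₀ : ℝ) (ε εd δ : ℕ → ℝ) (j₁ : ℕ), 0 < θ ∧ 0 ≤ C ∧ 0 < w₀ ∧ (∀ j, 0 ≤ ε j ∧ 0 ≤ εd j ∧ 0 ≤ δ j) ∧ Summable ε ∧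 Summable εd ∧ Summable δ ∧ Summable (fun i => ∑' k, δ (k + i)) ∧ Tendsto (fun j => (∑' k, δ (k + j)) * ((1 + 2 * ((F.L : ℝ) ^ j / γ) * (Fintype.card (Plaq (F.P j) 0) : ℝ)) * (Fintype.card (PBond (F.P j) 0) : ℝ) ^ 2)) atTop (𝓝 0) ∧ j₀ ≤ j₁ ∧ ∀ (ν : ℕ → (j : ℕ) → MeasureTheory.Measure (GaugeField (F.P j) 0 ↥(Matrix.specialUnitaryGroup (Fin 2) ℂ))), (∀ K, ν K K = T4GenFunBounds.gibbsMeasure (F.P K) ((F.scheme ℰp γ).β K)) → (∀ K j, j < K → ν K j = Measure.map (descend F ℰp j) (ν K (j + 1))) → ∀ (K K' : ℕ), K ≤ K' → ∀ (Ts T : ℕ), Ts < T → T ≤ K → ∀ (μ μ' : ((j : ℕ) → MeasureTheory.Measure (GaugeField (F.P j) 0 ↥(Matrix.specialUnitaryGroup (Fin 2) ℂ)))) (ρ ρ' : ((j : ℕ) → GaugeField (F.P j) 0 ↥(Matrix.specialUnitaryGroup (Fin 2) ℂ) → ℝ)), (∀ j : ℕ, Ts ≤ j → j ≤ T → μ j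 = ν K j ∧ μ' j = ν K' j) → (∀ j : ℕ, j < Ts → μ j = Measure.map (descend F ℰp j) ((μ (j + 1)).withDensity (fun U => ENNReal.ofReal (sfCut (θBal F.L γ b₀ p₀ (j + 1)) U))) ∧ μ' j = Measure.map (descend F ℰp j) ((μ' (j + 1)).withDensity (fun U => ENNReal.ofReal (sfCut (θBal F.L γ b₀ p₀ (j + 1)) U)))) → (∀ j : ℕ, Ts ≤ j → j < T → μ j = Measure.map (descend F ℰp j) (μ (j + 1)) ∧ μ' j = Measure.map (descend F ℰp j) (μ' (j + 1))) → (∀ j : ℕ, j ≤ T → IsFiniteMeasure (μ j) ∧ IsFiniteMeasure (μ' j)) → (∀ j : ℕ, j₀ ≤ j → j ≤ T → ((∀ U, PlaqSmall (θBal F.L γ b₀ p₀ j) U → 0 < ρ j U ∧ 0 < ρ' j U) ∧ μ j = (fieldMeasure _ _ _).withDensity (fun U => ENNReal.ofReal (ρ j U)) ∧ μ' j = (fieldMeasure _ _ _).withDensity (fun U => ENNReal.ofReal (ρ' j U)) ∧ (∃ κ : ℝ, MemAtHeight F ℰp j (prm j) (fun U => Real.exp κ * ρ j U)) ∧ (∃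 κ : ℝ, MemAtHeight F ℰp j (prm j) (fun U => Real.exp κ * ρ' j U)) ∧ μ j {U | ¬ PlaqSmall (θBal F.L γ b₀ p₀ j) U} ≤ ENNReal.ofReal (η j) ∧ μ' j {U | ¬ PlaqSmall (θBal F.L γ b₀ p₀ j) U} ≤ ENNReal.ofReal (η j) ∧ (ContinuousOn (ρ j) {U | PlaqSmall (θBal F.L γ b₀ p₀ j) U} ∧ ContinuousOn (ρ' j) {U | PlaqSmall (θBal F.L γ b₀ p₀ j) U}))) → ∀ (j : ℕ), j₁ ≤ j → j + 2 ≤ T → j + 1 ≤ Ts → ∀ (c : Plaq (F.P (j + 1)) 0 → ℝ) (a w : ℝ), 0 ≤ a → 0 ≤ w → a + θ / (((F.L : ℝ) ^ (j + 1) / γ) * θBal F.L γ b₀ p₀ (j + 1) ^ 2) * w ≤ w₀ → ((∀ p, |c p| ≤ a) ∧ (∀ (b b' : PBond (F.P (j + 1)) 0) U V W Z, PlaqSmall (θBal F.L γ b₀ p₀ (j + 1)) U → PlaqSmall (θBal F.L γ b₀ p₀ (j + 1)) V → PlaqSmall (θBal F.L γ b₀ p₀ (j + 1)) W → PlaqSmall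 (θBal F.L γ b₀ p₀ (j + 1)) Z → (∀ e, e ≠ b → U e = V e) → (∀ e, e ≠ b' → U e = W e) → (∀ e, e ≠ b' → V e = Z e) → (∀ e, e ≠ b → W e = Z e) → |(Real.log (ρ (j + 1) U) - Real.log (ρ' (j + 1) U) - ((F.L : ℝ) ^ (j + 1) / γ) * ∑ p, c p * (1 - reTr (GaugeField.plaqHol U p))) - (Real.log (ρ (j + 1) V) - Real.log (ρ' (j + 1) V) - ((F.L : ℝ) ^ (j + 1) / γ) * ∑ p, c p * (1 - reTr (GaugeField.plaqHol V p))) - ((Real.log (ρ (j + 1) W) - Real.log (ρ' (j + 1) W) - ((F.L : ℝ) ^ (j + 1) / γ) * ∑ p, c p * (1 - reTr (GaugeField.plaqHol W p))) - (Real.log (ρ (j + 1) Z) - Real.log (ρ' (j + 1) Z) - ((F.L : ℝ) ^ (j + 1) / γ) * ∑ p, c p * (1 - reTr (GaugeField.plaqHol Z p))))| ≤ w * Real.exp (-(κ * (b.src.tdist b'.src : ℝ))))) → ∃ (c' : Plaq (F.P j) 0 → ℝ) (a' w' : ℝ), 0 ≤ a' ∧ 0 ≤ w' ∧ a' + θ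 / (((F.L : ℝ) ^ j / γ) * θBal F.L γ b₀ p₀ j ^ 2) * w' ≤ (1 + ε j + εd (T - (j + 2)) + C * (a + θ / (((F.L : ℝ) ^ (j + 1) / γ) * θBal F.L γ b₀ p₀ (j + 1) ^ 2) * w)) * (a + θ / (((F.L : ℝ) ^ (j + 1) / γ) * θBal F.L γ b₀ p₀ (j + 1) ^ 2) * w) + δ j ∧ ((∀ p, |c' p| ≤ a') ∧ (∀ (b b' : PBond (F.P j) 0) U V W Z, PlaqSmall (θBal F.L γ b₀ p₀ j) U → PlaqSmall (θBal F.L γ b₀ p₀ j) V → PlaqSmall (θBal F.L γ b₀ p₀ j) W → PlaqSmall (θBal F.L γ b₀ p₀ j) Z → (∀ e, e ≠ b → U e = V e) → (∀ e, e ≠ b' → U e = W e) → (∀ e, e ≠ b' → V e = Z e) → (∀ e, e ≠ b → W e = Z e) → |(Real.log (ρ j U) - Real.log (ρ' j U) - ((F.L : ℝ) ^ j / γ) * ∑ p, c' p * (1 - reTr (GaugeField.plaqHol U p))) - (Real.log (ρ j V) - Real.log (ρ' j V) - ((F.L : ℝ) ^ j / γ) * ∑ p, c' p * (1 - reTr (GaugeField.plaqHol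 V p))) - ((Real.log (ρ j W) - Real.log (ρ' j W) - ((F.L : ℝ) ^ j / γ) * ∑ p, c' p * (1 - reTr (GaugeField.plaqHol W p))) - (Real.log (ρ j Z) - Real.log (ρ' j Z) - ((F.L : ℝ) ^ j / γ) * ∑ p, c' p * (1 - reTr (GaugeField.plaqHol Z p))))| ≤ w' * Real.exp (-(κ * (b.src.tdist b'.src : ℝ)))))

/-- VER∘ (v2; frame v2.4 = O1 v17's) · A WINDOW-CONTINUOUS VERSION OF THE LOCALISED FIBRE MEAN (row 1, size M; measure theory ∕ co-area, no Bałaban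
content).  For two finite class towers (O1's tower block verbatim) and a disintegration `σ` of product Haar along `descend` at height
`j` (the three properties of `FibreLaplace.stub_descentDisintegration`), the localised fibre mean
`V ↦ (∫ χ·h·ρ′_{j+1} dσ_V)/(∫ χ·ρ′_{j+1} dσ_V)`, `χ := sfCut θ_{j+1}`, `h := log ρ_{j+1} − log ρ′_{j+1}`, has a version `m` continuous on
the coarse Bałaban window, with `χ·h·ρ′_{j+1}` `σ_V`-integrable for Haar-a.e. window `V` (bounded: `supp χ ⊂ {∀ p, dist1 ≤ (24∕25)θ_{j+1}}`, a
COMPACT subset of the open fine window on which the frame's `ρ, ρ′` are continuous and positive, hence pinched by compactness — no `Mem`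
bound and no admissibility of `prm` is used; v2.1 ∕ census D25-5); v2.3 (census D25-6∕D25-7) states the row IN BAŁABAN'S PARAMETER REGIME `0 < γ ≤ 1`, `0 < b₀`, `0 < p₀` (VER∘ v2–v2.2
had no sign hypotheses: `θBal = √(γL^{-i})·b₀·(1 + log g⁻¹)^{p₀}` with real `rpow` of a negative base gave junk regimes — `θ_j > 0 ≥ θ_{j+1}` (empty fine
window, `χ ≡ 1`, nothing controls `h`: D25-6) and `0 < θ_{j+1} ≪ θ_j/L²` (window data whose fibre carries NO `χ`-mass, where `E′_χ = 0/0 := 0` jumps: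
D25-7) — both outside O1's `0 < γ ≤ γ₁ ≤ 1`, `0 < b₀`, `0 < p₀`, under which `θ_i > 0` and `θ_{j+1}/θ_j ≥ L^{-1/2}` at every height) and FROM A
HEIGHT `jV` ON (the averaging map must be a submersion on `{χ > 0}`, i.e. `θ_{j+1}L²` small — at low heights with `b₀` large the cut-off region
contains the singular set of the block average; O1 itself only works from its own `j₁` on, so the ★ junction takes `j₁ := max jL jJ jV`).  UNCONDITIONAL over the frame (v1's corner —
members with wild values off the small-field set — is invisible to `χ`; census D25-4 records why no cutoff-free version can be true).
Why it might fail: continuity in `V` needs the averaging map `descend` to be a submersion on `{χ > 0} ∩ descend⁻¹(window)` (small fine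
fields; true near the minimiser, to be checked on the whole cut-off region) and a positive `χ·ρ′`-mass of every window fibre (the
minimiser `U_⋆(V)` of a window datum has fine defects `≲ θ_j/L² < θ_{j+1}/2`); the a.e. identification is disintegration uniqueness.
Sources: [Balaban1985Averaging] (10)–(13), (19); [Balaban1985UV3] (42)–(44) p.266–267 (regular minimiser); Federer, co-area formula. -/
def FibreMeanVersionCan : Prop :=
  ∀ (F : T3Family) (γ b₀ p₀ : ℝ), 0 < γ → γ ≤ 1 → 0 < b₀ → 0 < p₀ → ∃ jV : ℕ, ∀ (j₀ : ℕ) (prm : ℕ → ClassParams) (η : ℕ → ℝ), ∀ (ν : ℕ → (j : ℕ) → MeasureTheory.Measure (GaugeField (F.P j) 0 ↥(Matrix.specialUnitaryGroup (Fin 2) ℂ))), (∀ K, ν K K = T4GenFunBounds.gibbsMeasure (F.P K) ((F.scheme ℰp γ).β K)) → (∀ K j, j < K → ν K j = Measure.map (descend F ℰp j) (ν K (j + 1))) → ∀ (K K' : ℕ), K ≤ K' → ∀ (Ts T : ℕ), Ts < T → T ≤ K → ∀ (μ μ' : ((j : ℕ) → MeasureTheory.Measure (GaugeField (F.P j) 0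 ↥(Matrix.specialUnitaryGroup (Fin 2) ℂ)))) (ρ ρ' : ((j : ℕ) → GaugeField (F.P j) 0 ↥(Matrix.specialUnitaryGroup (Fin 2) ℂ) → ℝ)), (∀ j : ℕ, Ts ≤ j → j ≤ T → μ j = ν K j ∧ μ' j = ν K' j) → (∀ j : ℕ, j < Ts → μ j = Measure.map (descend F ℰp j) ((μ (j + 1)).withDensity (fun U => ENNReal.ofReal (sfCut (θBal F.L γ b₀ p₀ (j + 1)) U))) ∧ μ' j = Measure.map (descend F ℰp j) ((μ' (j + 1)).withDensity (fun U => ENNReal.ofReal (sfCut (θBal F.L γ b₀ p₀ (j + 1)) U)))) → (∀ j : ℕ, Ts ≤ j → j < T → μ j = Measure.map (descend F ℰp j) (μ (j + 1)) ∧ μ' j = Measure.map (descend F ℰp j) (μ' (j + 1))) → (∀ j : ℕ, j ≤ T → IsFiniteMeasure (μ j) ∧ IsFiniteMeasure (μ' j)) → (∀ j : ℕ, j₀ ≤ j → j ≤ T → ((∀ U, PlaqSmall (θBal F.L γ b₀ p₀ j) U → 0 < ρ j U ∧ 0 < ρ' j U) ∧ μ j = (fieldMeasure _ _ _).withDensity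 (fun U => ENNReal.ofReal (ρ j U)) ∧ μ' j = (fieldMeasure _ _ _).withDensity (fun U => ENNReal.ofReal (ρ' j U)) ∧ (∃ κ : ℝ, MemAtHeight F ℰp j (prm j) (fun U => Real.exp κ * ρ j U)) ∧ (∃ κ : ℝ, MemAtHeight F ℰp j (prm j) (fun U => Real.exp κ * ρ' j U)) ∧ μ j {U | ¬ PlaqSmall (θBal F.L γ b₀ p₀ j) U} ≤ ENNReal.ofReal (η j) ∧ μ' j {U | ¬ PlaqSmall (θBal F.L γ b₀ p₀ j) U} ≤ ENNReal.ofReal (η j) ∧ (ContinuousOn (ρ j) {U | PlaqSmall (θBal F.L γ b₀ p₀ j) U} ∧ ContinuousOn (ρ' j) {U | PlaqSmall (θBal F.L γ b₀ p₀ j) U}))) → ∀ (j : ℕ), jV ≤ j → j₀ ≤ j → j + 1 ≤ T → ∀ (σ : ProbabilityTheory.Kernel (GaugeField (F.P j) 0 ↥(Matrix.specialUnitaryGroup (Fin 2) ℂ)) (GaugeField (F.P (j + 1)) 0 ↥(Matrix.specialUnitaryGroup (Fin 2) ℂ))), ProbabilityTheory.IsMarkovKernel σ → (Measure.map (descend F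 ℰp j) (fieldMeasure (F.P (j + 1)) 0 ↥(Matrix.specialUnitaryGroup (Fin 2) ℂ))).bind ⇑σ = fieldMeasure (F.P (j + 1)) 0 ↥(Matrix.specialUnitaryGroup (Fin 2) ℂ) → (∀ᵐ V ∂(Measure.map (descend F ℰp j) (fieldMeasure (F.P (j + 1)) 0 ↥(Matrix.specialUnitaryGroup (Fin 2) ℂ))), ∀ᵐ U ∂(σ V), descend F ℰp j U = V) → ∃ (m : GaugeField (F.P j) 0 ↥(Matrix.specialUnitaryGroup (Fin 2) ℂ) → ℝ), ContinuousOn m {V | PlaqSmall (θBal F.L γ b₀ p₀ j) V} ∧ (∀ᵐ V ∂(fieldMeasure (F.P j) 0 ↥(Matrix.specialUnitaryGroup (Fin 2) ℂ)), PlaqSmall (θBal F.L γ b₀ p₀ j) V → MeasureTheory.Integrable (fun U => sfCut (θBal F.L γ b₀ p₀ (j + 1)) U * (Real.log (ρ (j + 1) U) - Real.log (ρ' (j + 1) U)) * ρ' (j + 1) U) (σ V) ∧ m V = (∫ U, sfCut (θBal F.L γ b₀ p₀ (j + 1)) U * (Real.log (ρ (j + 1) U) - Real.log (ρ' (j + 1)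 U)) * ρ' (j + 1) U ∂(σ V)) / (∫ U, sfCut (θBal F.L γ b₀ p₀ (j + 1)) U * ρ' (j + 1) U ∂(σ V)))

/-- LIN∘ (frame v2.4 = O1 v17's; step below the seed `j + 1 ≤ Ts`) · TANGENT TRANSPORT (row 2, FIRST ORDER; size L–XL — linear response of Bałaban's backward step).  In O1's frame, for every
`θ ∈ (0, θ₀]` there are profiles `ε` (one-loop coupling discrepancy, `O(γL^{−j})`), `εd` (equilibration defect in the depth
`n = T − (j+2)`), a floor `δ` of O1's class and a smallness `w₀` such that the window-continuous LOCALISED fibre mean `m = E′_χ[h | ·]` (VER∘ v2) of the fine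
discrepancy `h` (presentation `(c, a, w)`, currency `x = a + Θ_{j+1} w ≤ w₀`) has a coarse presentation `(c′, a′, w′)` with the LINEAR
bound `a′ + Θ_j w′ ≤ (1 + ε_j + εd_n)·x + δ_j` — no `C`, no `x²`; for `κ ∈ (0, κ₀]` (O1-R1).  Mechanism: `h ↦ E′_χ[h | V]` is linear
(the χ-conditioned fibre law is the small-field fluctuation measure — the only part of the fibre Bałaban's expansions ever integrate over); on the marginal direction it is
classical restriction to the background (`A_{j+1} ∘ U_min = (1/L)·A_j + quasi-local spreading`, `β_{j+1}/(L β_j) = 1`) plus the one-loop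
`V`-dependence of the fluctuation covariance (`ε_j`); on window-clustered remainders it is averaging against a kernel with exponential
decay ([Balaban1985Propagators]); the equilibrated off-Wilson content of class inputs moves `Q_n → Q_{n+1}` at cost `εd_n` (KT-W).
Why it might fail: the irrelevant→marginal mixing of the tangent map must be `O(1)` in marginal units uniformly on the window for SOME
`j₁(θ)` (else no `θ₀`); a tower pair whose discrepancy is Wilson-exact at depth `n ≥ 1` would lose `θ·m` at once (excluded only by the
upward inadmissibility of tilted class members, KT-W (i)–(iii)).  Sources: [Balaban1987RG1] Thm 1, (0.22)–(0.30); [Balaban1988RG2] §1;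
[Balaban1985Propagators]; [Balaban1985UV3] (41)–(47). -/
def TangentTransportCan : Prop :=
  ∃ γ₁ : ℝ, 0 < γ₁ ∧ ∀ (F : T3Family) (γ : ℝ), 0 < γ → γ ≤ γ₁ → ∀ (b₀ p₀ : ℝ) (j₀ : ℕ) (prm : ℕ → ClassParams) (η : ℕ → ℝ), 0 < b₀ → 0 < p₀ → AdmissibleClassParams F γ b₀ p₀ prm → (∀ j, 0 ≤ η j) → Summable η → Summable (fun i => ∑' k, η (k + i)) → Tendsto (fun j => (∑' k, η (k + j)) * ((1 + 2 * ((F.L : ℝ) ^ j / γ) * (Fintype.card (Plaq (F.P j) 0) : ℝ)) * (Fintype.card (PBond (F.P j) 0) : ℝ) ^ 2)) atTop (𝓝 0) → ∃ κ₀ : ℝ, 0 < κ₀ ∧ ∀ (κ : ℝ), 0 < κ → κ ≤ κ₀ → ∃ θ₀ : ℝ, 0 < θ₀ ∧ ∀ (θ : ℝ), 0 < θ → θ ≤ θ₀ → ∃ (w₀ : ℝ) (ε εd δ : ℕ → ℝ) (j₁ : ℕ), 0 < w₀ ∧ (∀ j, 0 ≤ ε j ∧ 0 ≤ εd j ∧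 0 ≤ δ j) ∧ Summable ε ∧ Summable εd ∧ Summable δ ∧ Summable (fun i => ∑' k, δ (k + i)) ∧ Tendsto (fun j => (∑' k, δ (k + j)) * ((1 + 2 * ((F.L : ℝ) ^ j / γ) * (Fintype.card (Plaq (F.P j) 0) : ℝ)) * (Fintype.card (PBond (F.P j) 0) : ℝ) ^ 2)) atTop (𝓝 0) ∧ j₀ ≤ j₁ ∧ ∀ (ν : ℕ → (j : ℕ) → MeasureTheory.Measure (GaugeField (F.P j) 0 ↥(Matrix.specialUnitaryGroup (Fin 2) ℂ))), (∀ K, ν K K = T4GenFunBounds.gibbsMeasure (F.P K) ((F.scheme ℰp γ).β K)) → (∀ K j, j < K → ν K j = Measure.map (descend F ℰp j) (ν K (j + 1))) → ∀ (K K' : ℕ), K ≤ K' → ∀ (Ts T : ℕ), Ts < T → T ≤ K → ∀ (μ μ' : ((j : ℕ) → MeasureTheory.Measure (GaugeField (F.P j) 0 ↥(Matrix.specialUnitaryGroup (Fin 2) ℂ)))) (ρ ρ' : ((j : ℕ) → GaugeField (F.P j) 0 ↥(Matrix.specialUnitaryGroup (Fin 2) ℂ) → ℝ)), (∀ j : ℕ,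 Ts ≤ j → j ≤ T → μ j = ν K j ∧ μ' j = ν K' j) → (∀ j : ℕ, j < Ts → μ j = Measure.map (descend F ℰp j) ((μ (j + 1)).withDensity (fun U => ENNReal.ofReal (sfCut (θBal F.L γ b₀ p₀ (j + 1)) U))) ∧ μ' j = Measure.map (descend F ℰp j) ((μ' (j + 1)).withDensity (fun U => ENNReal.ofReal (sfCut (θBal F.L γ b₀ p₀ (j + 1)) U)))) → (∀ j : ℕ, Ts ≤ j → j < T → μ j = Measure.map (descend F ℰp j) (μ (j + 1)) ∧ μ' j = Measure.map (descend F ℰp j) (μ' (j + 1))) → (∀ j : ℕ, j ≤ T → IsFiniteMeasure (μ j) ∧ IsFiniteMeasure (μ' j)) → (∀ j : ℕ, j₀ ≤ j → j ≤ T → ((∀ U, PlaqSmall (θBal F.L γ b₀ p₀ j) U → 0 < ρ j U ∧ 0 < ρ' j U) ∧ μ j = (fieldMeasure _ _ _).withDensity (fun U => ENNReal.ofReal (ρ j U)) ∧ μ' j = (fieldMeasure _ _ _).withDensity (fun U => ENNReal.ofReal (ρ' j U)) ∧ (∃ κ : ℝ, MemAtHeight F ℰp j (prm j) (fun U => Real.exp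 κ * ρ j U)) ∧ (∃ κ : ℝ, MemAtHeight F ℰp j (prm j) (fun U => Real.exp κ * ρ' j U)) ∧ μ j {U | ¬ PlaqSmall (θBal F.L γ b₀ p₀ j) U} ≤ ENNReal.ofReal (η j) ∧ μ' j {U | ¬ PlaqSmall (θBal F.L γ b₀ p₀ j) U} ≤ ENNReal.ofReal (η j) ∧ (ContinuousOn (ρ j) {U | PlaqSmall (θBal F.L γ b₀ p₀ j) U} ∧ ContinuousOn (ρ' j) {U | PlaqSmall (θBal F.L γ b₀ p₀ j) U}))) → ∀ (j : ℕ), j₁ ≤ j → j + 2 ≤ T → j + 1 ≤ Ts → ∀ (σ : ProbabilityTheory.Kernel (GaugeField (F.P j) 0 ↥(Matrix.specialUnitaryGroup (Fin 2) ℂ)) (GaugeField (F.P (j + 1)) 0 ↥(Matrix.specialUnitaryGroup (Fin 2) ℂ))), ProbabilityTheory.IsMarkovKernel σ → (Measure.map (descend F ℰp j) (fieldMeasure (F.P (j + 1)) 0 ↥(Matrix.specialUnitaryGroup (Fin 2) ℂ))).bind ⇑σ = fieldMeasure (F.P (j + 1)) 0 ↥(Matrix.specialUnitaryGroup (Fin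 2) ℂ) → (∀ᵐ V ∂(Measure.map (descend F ℰp j) (fieldMeasure (F.P (j + 1)) 0 ↥(Matrix.specialUnitaryGroup (Fin 2) ℂ))), ∀ᵐ U ∂(σ V), descend F ℰp j U = V) → ∀ (m : GaugeField (F.P j) 0 ↥(Matrix.specialUnitaryGroup (Fin 2) ℂ) → ℝ), ContinuousOn m {V | PlaqSmall (θBal F.L γ b₀ p₀ j) V} → (∀ᵐ V ∂(fieldMeasure (F.P j) 0 ↥(Matrix.specialUnitaryGroup (Fin 2) ℂ)), PlaqSmall (θBal F.L γ b₀ p₀ j) V → MeasureTheory.Integrable (fun U => sfCut (θBal F.L γ b₀ p₀ (j + 1)) U * (Real.log (ρ (j + 1) U) - Real.log (ρ' (j + 1) U)) * ρ' (j + 1) U) (σ V) ∧ m V = (∫ U, sfCut (θBal F.L γ b₀ p₀ (j + 1)) U * (Real.log (ρ (j + 1) U) - Real.log (ρ' (j + 1) U)) * ρ' (j + 1) U ∂(σ V)) / (∫ U, sfCut (θBal F.L γ b₀ p₀ (j + 1)) U * ρ' (j + 1) U ∂(σ V))) → ∀ (c : Plaq (F.P (j + 1)) 0 → ℝ) (a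 w : ℝ), 0 ≤ a → 0 ≤ w → a + θ / (((F.L : ℝ) ^ (j + 1) / γ) * θBal F.L γ b₀ p₀ (j + 1) ^ 2) * w ≤ w₀ → ((∀ p, |c p| ≤ a) ∧ (∀ (b b' : PBond (F.P (j + 1)) 0) U V W Z, PlaqSmall (θBal F.L γ b₀ p₀ (j + 1)) U → PlaqSmall (θBal F.L γ b₀ p₀ (j + 1)) V → PlaqSmall (θBal F.L γ b₀ p₀ (j + 1)) W → PlaqSmall (θBal F.L γ b₀ p₀ (j + 1)) Z → (∀ e, e ≠ b → U e = V e) → (∀ e, e ≠ b' → U e = W e) → (∀ e, e ≠ b' → V e = Z e) → (∀ e, e ≠ b → W e = Z e) → |(Real.log (ρ (j + 1) U) - Real.log (ρ' (j + 1) U) - ((F.L : ℝ) ^ (j + 1) / γ) * ∑ p, c p * (1 - reTr (GaugeField.plaqHol U p))) - (Real.log (ρ (j + 1) V) - Real.log (ρ' (j + 1) V) - ((F.L : ℝ) ^ (j + 1) / γ) * ∑ p, c p * (1 - reTr (GaugeField.plaqHol V p))) - ((Real.log (ρ (j + 1) W) - Real.log (ρ' (j + 1) W) - ((F.L : ℝ)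 ^ (j + 1) / γ) * ∑ p, c p * (1 - reTr (GaugeField.plaqHol W p))) - (Real.log (ρ (j + 1) Z) - Real.log (ρ' (j + 1) Z) - ((F.L : ℝ) ^ (j + 1) / γ) * ∑ p, c p * (1 - reTr (GaugeField.plaqHol Z p))))| ≤ w * Real.exp (-(κ * (b.src.tdist b'.src : ℝ))))) → ∃ (c' : Plaq (F.P j) 0 → ℝ) (a' w' : ℝ), 0 ≤ a' ∧ 0 ≤ w' ∧ a' + θ / (((F.L : ℝ) ^ j / γ) * θBal F.L γ b₀ p₀ j ^ 2) * w' ≤ (1 + ε j + εd (T - (j + 2))) * (a + θ / (((F.L : ℝ) ^ (j + 1) / γ) * θBal F.L γ b₀ p₀ (j + 1) ^ 2) * w) + δ j ∧ ((∀ p, |c' p| ≤ a') ∧ (∀ (b b' : PBond (F.P j) 0) U V W Z, PlaqSmall (θBal F.L γ b₀ p₀ j) U → PlaqSmall (θBal F.L γ b₀ p₀ j) V → PlaqSmall (θBal F.L γ b₀ p₀ j) W → PlaqSmall (θBal F.L γ b₀ p₀ j) Z → (∀ e, e ≠ b → U e = V e) → (∀ e, e ≠ b' → U e = W e) → (∀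 e, e ≠ b' → V e = Z e) → (∀ e, e ≠ b → W e = Z e) → |(m U - ((F.L : ℝ) ^ j / γ) * ∑ p, c' p * (1 - reTr (GaugeField.plaqHol U p))) - (m V - ((F.L : ℝ) ^ j / γ) * ∑ p, c' p * (1 - reTr (GaugeField.plaqHol V p))) - ((m W - ((F.L : ℝ) ^ j / γ) * ∑ p, c' p * (1 - reTr (GaugeField.plaqHol W p))) - (m Z - ((F.L : ℝ) ^ j / γ) * ∑ p, c' p * (1 - reTr (GaugeField.plaqHol Z p))))| ≤ w' * Real.exp (-(κ * (b.src.tdist b'.src : ℝ)))))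

/-- JEN∘ · JENSEN GAP (row 3, SECOND ORDER; size L — conditional cumulants on the small-field fibre; v2.4: under the v17 SF-projected frame
`h_j − m` involves NO collar ∕ large-field fibre mass — `ρ_j = Z_j ∫ χρ_{j+1} dσ` below the seed — so only the χ-part of the mechanism below
remains and `δ_j` carries no Wilson-collar weight; COLLAR∘ of LINE g25-4 is moot).  In O1's frame, for every
`θ ∈ (0, θ₀]` there are `C ≥ 0`, a floor `δ` of O1's class and `w₀ > 0` such that the Jensen gap
`q := (log ρ_j − log ρ′_j) − m = log E′[exp(h − m(V)) | V]` (`≥ log E′[χ | V]`) of the window-continuous LOCALISED fibre mean `m = E′_χ[h | ·]`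
(VER∘ v2) is window-clustered at the coarse height with 4-point size `w′_q`, `Θ_j w′_q ≤ C·x·x + δ_j` — QUADRATIC plus floor, no linear
term; for `κ ∈ (0, κ₀]` (O1-R1).  Mechanism: split `E′[e^{h−m} | V] = E′[χe^{h−m} | V] + E′[(1−χ)e^{h−m} | V]`; the χ-part is
`E′[χ | V]·exp(∫₀¹ (1−t)·Var′_{χ,t}(h | V) dt)` (log-Laplace Taylor formula along the tilt `χe^{t(h−m)}`, centred since `m = E′_χ[h | V]`);
the `(1−χ)`-part (collar `θ_{j+1}/2 ≤ defect < θ_{j+1}` and large fields) is a fibre mass of Wilson weight `e^{−β_{j+1}θ_{j+1}²/4}` resp.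
`Mem.large` — floor class; on the small-field fibre the reference
law is uniformly log-concave at scale `1/β_{j+1}` around the background TRANSVERSE TO GAUGE ORBITS (Bałaban's gauge-fixed fluctuation
action: the averaging constraint removes the constant modes, one scale only), so Brascamp–Lieb / Bakry–Émery on `SU(2)^{bonds}` bounds
`Var′(h | V) ≤ ⟨∇h, G_V ∇h⟩`, and the `V`-dependence of the fibre covariance `G_V` is quasi-local ([Balaban1985Propagators]); in
marginal units this is `≤ C(θ, L)·x²`, `C` uniform in `j`; large fields go to the floor.
Why it might fail: the constant is `C ≍ L·C_geom/θ` from the remainder⊗remainder channel — uniform in `j` only if the fibre covariance's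
mixed second differences in the datum carry no extra power of `p(g_j)`; the tilted fibre laws `e^{t(h−m)}dσ′_V`, `t ∈ [0,1]`, must stay
uniformly log-concave on the window (true for small `x ≤ w₀` only); `h` and `m` are gauge-invariant, so only transverse convexity is
needed, but the positive curvature of `SU(2)` must not be spent twice (cf. the strong-coupling Bakry–Émery LSI of arXiv:2204.12737, a
different regime).  Nearest prior art for the tangent/Hessian structure: the multiscale Bakry–Émery method for the Polchinski flow
(arXiv:2307.07619 §3.4: first derivative of the renormalised potential = fluctuation-measure expectation, Hessian = variance, Brascamp–Lieb),
scalar fields, continuous flow — here: two lattice GAUGE towers, ONE block-averaging step, discrepancy not potential.  Sources: [Balaban1987RG1] §2 (second-order terms of the effective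
action), [Balaban1985Propagators], Brascamp–Lieb (1976) Thm 4.1; [Balaban1989LargeFieldII] §1 for the floor. -/
def JensenGapCan : Prop :=
  ∃ γ₁ : ℝ, 0 < γ₁ ∧ ∀ (F : T3Family) (γ : ℝ), 0 < γ → γ ≤ γ₁ → ∀ (b₀ p₀ : ℝ) (j₀ : ℕ) (prm : ℕ → ClassParams) (η : ℕ → ℝ), 0 < b₀ → 0 < p₀ → AdmissibleClassParams F γ b₀ p₀ prm → (∀ j, 0 ≤ η j) → Summable η → Summable (fun i => ∑' k, η (k + i)) → Tendsto (fun j => (∑' k, η (k + j)) * ((1 + 2 * ((F.L : ℝ) ^ j / γ) * (Fintype.card (Plaq (F.P j) 0) : ℝ)) * (Fintype.card (PBond (F.P j) 0) : ℝ) ^ 2)) atTop (𝓝 0) → ∃ κ₀ : ℝ, 0 < κ₀ ∧ ∀ (κ : ℝ), 0 < κ → κ ≤ κ₀ → ∃ θ₀ : ℝ, 0 < θ₀ ∧ ∀ (θ : ℝ), 0 < θ → θ ≤ θ₀ → ∃ (C w₀ : ℝ) (δ : ℕ → ℝ) (j₁ : ℕ), 0 ≤ C ∧ 0 < w₀ ∧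 (∀ j, 0 ≤ δ j) ∧ Summable δ ∧ Summable (fun i => ∑' k, δ (k + i)) ∧ Tendsto (fun j => (∑' k, δ (k + j)) * ((1 + 2 * ((F.L : ℝ) ^ j / γ) * (Fintype.card (Plaq (F.P j) 0) : ℝ)) * (Fintype.card (PBond (F.P j) 0) : ℝ) ^ 2)) atTop (𝓝 0) ∧ j₀ ≤ j₁ ∧ ∀ (ν : ℕ → (j : ℕ) → MeasureTheory.Measure (GaugeField (F.P j) 0 ↥(Matrix.specialUnitaryGroup (Fin 2) ℂ))), (∀ K, ν K K = T4GenFunBounds.gibbsMeasure (F.P K) ((F.scheme ℰp γ).β K)) → (∀ K j, j < K → ν K j = Measure.map (descend F ℰp j) (ν K (j + 1))) → ∀ (K K' : ℕ), K ≤ K' → ∀ (Ts T : ℕ), Ts < T → T ≤ K → ∀ (μ μ' : ((j : ℕ) → MeasureTheory.Measure (GaugeField (F.P j) 0 ↥(Matrix.specialUnitaryGroup (Fin 2) ℂ)))) (ρ ρ' : ((j : ℕ) → GaugeField (F.P j) 0 ↥(Matrix.specialUnitaryGroup (Fin 2) ℂ) → ℝ)), (∀ j : ℕ, Ts ≤ j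 → j ≤ T → μ j = ν K j ∧ μ' j = ν K' j) → (∀ j : ℕ, j < Ts → μ j = Measure.map (descend F ℰp j) ((μ (j + 1)).withDensity (fun U => ENNReal.ofReal (sfCut (θBal F.L γ b₀ p₀ (j + 1)) U))) ∧ μ' j = Measure.map (descend F ℰp j) ((μ' (j + 1)).withDensity (fun U => ENNReal.ofReal (sfCut (θBal F.L γ b₀ p₀ (j + 1)) U)))) → (∀ j : ℕ, Ts ≤ j → j < T → μ j = Measure.map (descend F ℰp j) (μ (j + 1)) ∧ μ' j = Measure.map (descend F ℰp j) (μ' (j + 1))) → (∀ j : ℕ, j ≤ T → IsFiniteMeasure (μ j) ∧ IsFiniteMeasure (μ' j)) → (∀ j : ℕ, j₀ ≤ j → j ≤ T → ((∀ U, PlaqSmall (θBal F.L γ b₀ p₀ j) U → 0 < ρ j U ∧ 0 < ρ' j U) ∧ μ j = (fieldMeasure _ _ _).withDensity (fun U => ENNReal.ofReal (ρ j U)) ∧ μ' j = (fieldMeasure _ _ _).withDensity (fun U => ENNReal.ofReal (ρ' j U)) ∧ (∃ κ : ℝ, MemAtHeight F ℰp j (prm j) (fun U => Real.exp κ * ρ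 j U)) ∧ (∃ κ : ℝ, MemAtHeight F ℰp j (prm j) (fun U => Real.exp κ * ρ' j U)) ∧ μ j {U | ¬ PlaqSmall (θBal F.L γ b₀ p₀ j) U} ≤ ENNReal.ofReal (η j) ∧ μ' j {U | ¬ PlaqSmall (θBal F.L γ b₀ p₀ j) U} ≤ ENNReal.ofReal (η j) ∧ (ContinuousOn (ρ j) {U | PlaqSmall (θBal F.L γ b₀ p₀ j) U} ∧ ContinuousOn (ρ' j) {U | PlaqSmall (θBal F.L γ b₀ p₀ j) U}))) → ∀ (j : ℕ), j₁ ≤ j → j + 2 ≤ T → j + 1 ≤ Ts → ∀ (σ : ProbabilityTheory.Kernel (GaugeField (F.P j) 0 ↥(Matrix.specialUnitaryGroup (Fin 2) ℂ)) (GaugeField (F.P (j + 1)) 0 ↥(Matrix.specialUnitaryGroup (Fin 2) ℂ))), ProbabilityTheory.IsMarkovKernel σ → (Measure.map (descend F ℰp j) (fieldMeasure (F.P (j + 1)) 0 ↥(Matrix.specialUnitaryGroup (Fin 2) ℂ))).bind ⇑σ = fieldMeasure (F.P (j + 1)) 0 ↥(Matrix.specialUnitaryGroup (Fin 2) ℂ)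 → (∀ᵐ V ∂(Measure.map (descend F ℰp j) (fieldMeasure (F.P (j + 1)) 0 ↥(Matrix.specialUnitaryGroup (Fin 2) ℂ))), ∀ᵐ U ∂(σ V), descend F ℰp j U = V) → ∀ (m : GaugeField (F.P j) 0 ↥(Matrix.specialUnitaryGroup (Fin 2) ℂ) → ℝ), ContinuousOn m {V | PlaqSmall (θBal F.L γ b₀ p₀ j) V} → (∀ᵐ V ∂(fieldMeasure (F.P j) 0 ↥(Matrix.specialUnitaryGroup (Fin 2) ℂ)), PlaqSmall (θBal F.L γ b₀ p₀ j) V → MeasureTheory.Integrable (fun U => sfCut (θBal F.L γ b₀ p₀ (j + 1)) U * (Real.log (ρ (j + 1) U) - Real.log (ρ' (j + 1) U)) * ρ' (j + 1) U) (σ V) ∧ m V = (∫ U, sfCut (θBal F.L γ b₀ p₀ (j + 1)) U * (Real.log (ρ (j + 1) U) - Real.log (ρ' (j + 1) U)) * ρ' (j + 1) U ∂(σ V)) / (∫ U, sfCut (θBal F.L γ b₀ p₀ (j + 1)) U * ρ' (j + 1) U ∂(σ V))) → ∀ (c : Plaq (F.P (j + 1)) 0 → ℝ) (a w : ℝ),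 0 ≤ a → 0 ≤ w → a + θ / (((F.L : ℝ) ^ (j + 1) / γ) * θBal F.L γ b₀ p₀ (j + 1) ^ 2) * w ≤ w₀ → ((∀ p, |c p| ≤ a) ∧ (∀ (b b' : PBond (F.P (j + 1)) 0) U V W Z, PlaqSmall (θBal F.L γ b₀ p₀ (j + 1)) U → PlaqSmall (θBal F.L γ b₀ p₀ (j + 1)) V → PlaqSmall (θBal F.L γ b₀ p₀ (j + 1)) W → PlaqSmall (θBal F.L γ b₀ p₀ (j + 1)) Z → (∀ e, e ≠ b → U e = V e) → (∀ e, e ≠ b' → U e = W e) → (∀ e, e ≠ b' → V e = Z e) → (∀ e, e ≠ b → W e = Z e) → |(Real.log (ρ (j + 1) U) - Real.log (ρ' (j + 1) U) - ((F.L : ℝ) ^ (j + 1) / γ) * ∑ p, c p * (1 - reTr (GaugeField.plaqHol U p))) - (Real.log (ρ (j + 1) V) - Real.log (ρ' (j + 1) V) - ((F.L : ℝ) ^ (j + 1) / γ) * ∑ p, c p * (1 - reTr (GaugeField.plaqHol V p))) - ((Real.log (ρ (j + 1) W) - Real.log (ρ' (j + 1) W) - ((F.L : ℝ) ^ (j +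 1) / γ) * ∑ p, c p * (1 - reTr (GaugeField.plaqHol W p))) - (Real.log (ρ (j + 1) Z) - Real.log (ρ' (j + 1) Z) - ((F.L : ℝ) ^ (j + 1) / γ) * ∑ p, c p * (1 - reTr (GaugeField.plaqHol Z p))))| ≤ w * Real.exp (-(κ * (b.src.tdist b'.src : ℝ))))) → ∃ (w' : ℝ), 0 ≤ w' ∧ θ / (((F.L : ℝ) ^ j / γ) * θBal F.L γ b₀ p₀ j ^ 2) * w' ≤ C * (a + θ / (((F.L : ℝ) ^ (j + 1) / γ) * θBal F.L γ b₀ p₀ (j + 1) ^ 2) * w) * (a + θ / (((F.L : ℝ) ^ (j + 1) / γ) * θBal F.L γ b₀ p₀ (j + 1) ^ 2) * w) + δ j ∧ (∀ (b b' : PBond (F.P j) 0) U V W Z, PlaqSmall (θBal F.L γ b₀ p₀ j) U → PlaqSmall (θBal F.L γ b₀ p₀ j) V → PlaqSmall (θBal F.L γ b₀ p₀ j) W → PlaqSmall (θBal F.L γ b₀ p₀ j) Z → (∀ e, e ≠ b → U e = V e) → (∀ e, e ≠ b' → U e = W e) → (∀ e, e ≠ b' → V e = Z e) → (∀ e, e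 ≠ b → W e = Z e) → |(Real.log (ρ j U) - Real.log (ρ' j U) - m U) - (Real.log (ρ j V) - Real.log (ρ' j V) - m V) - ((Real.log (ρ j W) - Real.log (ρ' j W) - m W) - (Real.log (ρ j Z) - Real.log (ρ' j Z) - m Z))| ≤ w' * Real.exp (-(κ * (b.src.tdist b'.src : ℝ))))

/-- stub (VER∘ v2). -/
theorem stub_fibreMeanVersion : FibreMeanVersionCan := by
  sorry

/-- stub (LIN∘). -/
theorem stub_tangentTransport : TangentTransportCan := by
  sorry

/-- stub (JEN∘). -/
theorem stub_jensenGap : JensenGapCan := by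
  sorry

/-- ★ JUNCTION (kernel-checked, no sorry): the Taylor split re-assembles the organ.  `h_j = m + (h_j − m)` pointwise on the window,
`c′ := c′_lin`, `a′ := a′_lin`, `w′ := w′_lin + w′_q` (4-point subadditivity), `γ₁ := min γ₁ᴸ γ₁ᴶ 1` (VER∘ v2.3 lives in `γ ≤ 1`), `κ₀ := min κ₀ᴸ κ₀ᴶ`, `θ := min θ₀ᴸ θ₀ᴶ`, `w₀ := min`, `j₁ := max jL jJ jV`,
`δ := δᴸ + δᴶ` (floor class closed under `+`), and `((1 + ε + εd)·x + δᴸ) + (C·x·x + δᴶ) = (1 + ε + εd + C·x)·x + δ`. -/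
theorem oneStepContractionRun_of_tangentCut
    (hV : FibreMeanVersionCan) (hL : TangentTransportCan) (hJ : JensenGapCan) :
    OneStepContractionRun := by
  obtain ⟨γL, hγL, hL⟩ := hL
  obtain ⟨γJ, hγJ, hJ⟩ := hJ
  refine ⟨min (min γL γJ) 1, lt_min (lt_min hγL hγJ) one_pos, ?_⟩
  intro F γ hγ hγ1 b₀ p₀ j₀ prm η hb₀ hp₀ hadm hη0 hηs hηss hηt
  have hγone : γ ≤ 1 := hγ1.trans (min_le_right _ _)
  obtain ⟨jV, hV⟩ := hV F γ b₀ p₀ hγ hγone hb₀ hp₀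
  obtain ⟨κL, hκL, hL⟩ := hL F γ hγ (hγ1.trans ((min_le_left _ _).trans (min_le_left _ _))) b₀ p₀ j₀ prm η hb₀ hp₀ hadm hη0 hηs hηss hηt
  obtain ⟨κJ, hκJ, hJ⟩ := hJ F γ hγ (hγ1.trans ((min_le_left _ _).trans (min_le_right _ _))) b₀ p₀ j₀ prm η hb₀ hp₀ hadm hη0 hηs hηss hηt
  refine ⟨min κL κJ, lt_min hκL hκJ, ?_⟩
  intro κ hκ hκle
  obtain ⟨θL, hθL, hL⟩ := hL κ hκ (hκle.trans (min_le_left _ _))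
  obtain ⟨θJ, hθJ, hJ⟩ := hJ κ hκ (hκle.trans (min_le_right _ _))
  obtain ⟨wL, ε, εd, δL, jL, hwL, hnnL, hεs, hεds, hδLs, hδLss, hδLt, hjL, hL⟩ :=
    hL (min θL θJ) (lt_min hθL hθJ) (min_le_left _ _)
  obtain ⟨C, wJ, δJ, jJ, hC, hwJ, hnnJ, hδJs, hδJss, hδJt, hjJ, hJ⟩ :=
    hJ (min θL θJ) (lt_min hθL hθJ) (min_le_right _ _)
  have h1 : ∀ i, Summable (fun k => δL (k + i)) := fun i => (summable_nat_add_iff i).mpr hδLs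
  have h2 : ∀ i, Summable (fun k => δJ (k + i)) := fun i => (summable_nat_add_iff i).mpr hδJs
  refine ⟨min θL θJ, C, min wL wJ, ε, εd, fun j => δL j + δJ j, max (max jL jJ) jV, lt_min hθL hθJ, hC, lt_min hwL hwJ, ?_,
    hεs, hεds, hδLs.add hδJs, ?_, ?_, hjL.trans ((le_max_left jL jJ).trans (le_max_left (max jL jJ) jV)), ?_⟩
  · intro j
    exact ⟨(hnnL j).1, (hnnL j).2.1, add_nonneg (hnnL j).2.2 (hnnJ j)⟩
  · have key : (fun i => ∑' k, (δL (k + i) + δJ (k + i))) =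
        fun i => (∑' k, δL (k + i)) + ∑' k, δJ (k + i) := by
      funext i
      exact (h1 i).tsum_add (h2 i)
    rw [key]
    exact hδLss.add hδJss
  · have key : (fun j => (∑' k, (δL (k + j) + δJ (k + j))) * ((1 + 2 * ((F.L : ℝ) ^ j / γ) * (Fintype.card (Plaq (F.P j) 0) : ℝ)) * (Fintype.card (PBond (F.P j) 0) : ℝ) ^ 2)) =
        fun j => (∑' k, δL (k + j)) * ((1 + 2 * ((F.L : ℝ) ^ j / γ) * (Fintype.card (Plaq (F.P j) 0) : ℝ)) * (Fintype.card (PBond (F.P j) 0) : ℝ) ^ 2) +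
          (∑' k, δJ (k + j)) * ((1 + 2 * ((F.L : ℝ) ^ j / γ) * (Fintype.card (Plaq (F.P j) 0) : ℝ)) * (Fintype.card (PBond (F.P j) 0) : ℝ) ^ 2) := by
      funext j
      rw [(h1 j).tsum_add (h2 j), add_mul]
    rw [key]
    simpa using hδLt.add hδJt
  · intro ν hG hCν K K' hKK' Ts T hTs hTK μ μ' ρ ρ' hanch hcut hcons hfin hwin j hj hjT hjTs c a w ha hw hx hin
    obtain ⟨σ, hσM, hσb, hσf⟩ :=
      Summit.QuantumFields.YangMills.Theorems.BackwardLiouvilleRigidity.FibreLaplace.stub_descentDisintegration F j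
    have hjLJ : max jL jJ ≤ j := (le_max_left (max jL jJ) jV).trans hj
    have hj₀ : j₀ ≤ j := hjL.trans ((le_max_left jL jJ).trans hjLJ)
    have hjT' : j + 1 ≤ T := by omega
    obtain ⟨m, hmc, hmae⟩ :=
      hV j₀ prm η ν hG hCν K K' hKK' Ts T hTs hTK μ μ' ρ ρ' hanch hcut hcons hfin hwin j ((le_max_right (max jL jJ) jV).trans hj) hj₀ hjT' σ hσM hσb hσf
    obtain ⟨c', a', w₁, ha', hw₁, hbdL, hc', h4L⟩ :=
      hL ν hG hCν K K' hKK' Ts T hTs hTK μ μ' ρ ρ' hanch hcut hcons hfin hwin j ((le_max_left jL jJ).trans hjLJ) hjT hjTs σ hσM hσb hσf m hmc hmae c a w ha hw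
        (hx.trans (min_le_left _ _)) hin
    obtain ⟨w₂, hw₂, hbdJ, h4J⟩ :=
      hJ ν hG hCν K K' hKK' Ts T hTs hTK μ μ' ρ ρ' hanch hcut hcons hfin hwin j ((le_max_right jL jJ).trans hjLJ) hjT hjTs σ hσM hσb hσf m hmc hmae c a w ha hw
        (hx.trans (min_le_right _ _)) hin
    refine ⟨c', a', w₁ + w₂, ha', add_nonneg hw₁ hw₂, ?_, hc', ?_⟩
    · linear_combination hbdL + hbdJ
    · intro b b' U V W Z hU hV' hW hZ e1 e2 e3 e4
      have A := h4L b b' U V W Z hU hV' hW hZ e1 e2 e3 e4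
      have B := h4J b b' U V W Z hU hV' hW hZ e1 e2 e3 e4
      have hsum := add_le_add A B
      rw [← add_mul] at hsum
      refine le_trans ?_ hsum
      refine le_trans (le_of_eq ?_) (abs_add_le _ _)
      congr 1
      ring

end Summit.QuantumFields.YangMills.Cruxes.FluctuationComparisonRegPrIntL.OrganTangent
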